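import Mathlib.Analysis.SpecialFunctions.Pow.Real
import HarnessLib

/-!
# `NoHeavyLowerTail` (crux stmt-CriticalPhenomena-4575), abstract sunflower cubic: SAFETY IS PRESERVED BY ADDING A DISJOINT EDGE —
# the analytic half, degenerate case `μ(A) = 0`

Support file (seat `prim-ineq-prove-1` gen 43; `--supports stmt-CriticalPhenomena-4575`).  No `sorry`, no named facts.
Memo: run/shared/lean/prim/prim-ineq-prove-1/FINDING-COSTGAME-prove1-g43.md §5.  Companion of `…SunflowerUnionEdgeAnalytic`.

When the old core has measure `a = 0`, safety of the old core only says that the `10`-sections (and the `01`-sections) of two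
distinct petals have product zero (Harris).  The two-coin bound survives with the blocks merged by SUMS instead of products:
* `ffun s t u v = st + s(1−t)u + (1−s)t·v + (1−s)(1−t)·min u v`; **`ffun_merge`**: `ffun u₁ v₁ · ffun u₂ v₂ ≤ st · ffun (u₁+u₂) (v₁+v₂)`
  when `u₁u₂ = 0 = v₁v₂` (uses `min(u,v) ≥ uv` on the unit square); `prod_ffun_le_merged` (induction);
* **`two_coin_prod_le_zero`**: `∏_j (st·x_j + s(1−t)u_j + (1−s)t·v_j + (1−s)(1−t)m_j) ≤ (st)^(K−1)` under the pairwise constraints.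
-/

noncomputable section

namespace Summit.CriticalPhenomena.PercolationContinuityZ3.Theorems.SunflowerPartition

namespace SafeCalc

namespace UnionEdge

open Finset

/-! ## The two-coin bound, `a = 0` (pairwise constraints, merging by sums) -/

/-- The two-coin factor with `min`: `ffun s t u v = st + s(1−t)u + (1−s)t·v + (1−s)(1−t)·min u v`. [this work] -/
def ffun (s t u v : ℝ) : ℝ := s * t + s * (1 - t) * u + (1 - s) * t * v + (1 - s) * (1 - t) * min u v

/-- **Sum-merge** (the `a = 0` case): if `u₁u₂ = 0 = v₁v₂` (all in `[0,1]`) then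
`ffun u₁ v₁ · ffun u₂ v₂ ≤ st · ffun (u₁+u₂) (v₁+v₂)` (uses `min(u,v) ≥ uv` on `[0,1]`). [this work] -/
theorem ffun_merge {s t u₁ v₁ u₂ v₂ : ℝ} (hs : 0 ≤ s) (hs1 : s ≤ 1) (ht : 0 ≤ t) (ht1 : t ≤ 1)
    (hu₁ : 0 ≤ u₁) (hu₁' : u₁ ≤ 1) (hv₁ : 0 ≤ v₁) (hv₁' : v₁ ≤ 1) (hu₂ : 0 ≤ u₂) (hu₂' : u₂ ≤ 1)
    (hv₂ : 0 ≤ v₂) (hv₂' : v₂ ≤ 1) (hu : u₁ * u₂ = 0) (hv : v₁ * v₂ = 0) :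
    ffun s t u₁ v₁ * ffun s t u₂ v₂ ≤ s * t * ffun s t (u₁ + u₂) (v₁ + v₂) := by
  have hs' : 0 ≤ 1 - s := by linarith
  have ht' : 0 ≤ 1 - t := by linarith
  have hst : 0 ≤ s * t := mul_nonneg hs ht
  have hR : 0 ≤ s * t * ((1 - s) * (1 - t)) := mul_nonneg hst (mul_nonneg hs' ht')
  -- `min(u,v) ≥ uv` on the unit square
  have minmul : ∀ {u v : ℝ}, 0 ≤ u → u ≤ 1 → 0 ≤ v → v ≤ 1 → u * v ≤ min u v := by
    intro u v hu0 hu1 hv0 hv1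
    rcases le_total u v with h | h
    · rw [min_eq_left h]; nlinarith
    · rw [min_eq_right h]; nlinarith
  unfold ffun
  rcases mul_eq_zero.1 hu with h1 | h1 <;> rcases mul_eq_zero.1 hv with h2 | h2 <;> subst h1 <;> subst h2
  · -- u₁ = 0, v₁ = 0
    rw [min_self, zero_add, zero_add]
    have : 0 ≤ min u₂ v₂ := le_min hu₂ hv₂
    nlinarith [mul_nonneg hR this, mul_nonneg hst (mul_nonneg (mul_nonneg hs ht') hu₂),
      mul_nonneg hst (mul_nonneg (mul_nonneg hs' ht) hv₂)]
  · -- u₁ = 0, v₂ = 0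
    rw [min_eq_left hv₁, min_eq_right hu₂, zero_add, add_zero]
    have k := minmul hu₂ hu₂' hv₁ hv₁'
    nlinarith [mul_le_mul_of_nonneg_left k hR, mul_nonneg hst (mul_nonneg (mul_nonneg hs ht') hu₂),
      mul_nonneg hst (mul_nonneg (mul_nonneg hs' ht) hv₁), mul_nonneg (mul_nonneg (mul_nonneg hs ht') hu₂)
      (mul_nonneg (mul_nonneg hs' ht) hv₁)]
  · -- u₂ = 0, v₁ = 0
    rw [min_eq_right hu₁, min_eq_left hv₂, add_zero, zero_add]
    have k := minmul hu₁ hu₁' hv₂ hv₂'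
    nlinarith [mul_le_mul_of_nonneg_left k hR, mul_nonneg hst (mul_nonneg (mul_nonneg hs ht') hu₁),
      mul_nonneg hst (mul_nonneg (mul_nonneg hs' ht) hv₂), mul_nonneg (mul_nonneg (mul_nonneg hs ht') hu₁)
      (mul_nonneg (mul_nonneg hs' ht) hv₂)]
  · -- u₂ = 0, v₂ = 0
    rw [min_self, add_zero, add_zero]
    have : 0 ≤ min u₁ v₁ := le_min hu₁ hv₁
    nlinarith [mul_nonneg hR this, mul_nonneg hst (mul_nonneg (mul_nonneg hs ht') hu₁),
      mul_nonneg hst (mul_nonneg (mul_nonneg hs' ht) hv₁)]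

/-- Sum-merging induction (`a = 0`): pairwise-orthogonal blocks in `[0,1]`. [this work] -/
theorem prod_ffun_le_merged {κ : Type*} [DecidableEq κ] {s t : ℝ} (hs : 0 ≤ s) (hs1 : s ≤ 1) (ht : 0 ≤ t)
    (ht1 : t ≤ 1) (u v : κ → ℝ) (hu0 : ∀ j, 0 ≤ u j) (hu1 : ∀ j, u j ≤ 1) (hv0 : ∀ j, 0 ≤ v j) (hv1 : ∀ j, v j ≤ 1)
    (hu : ∀ i j, i ≠ j → u i * u j = 0) (hv : ∀ i j, i ≠ j → v i * v j = 0) :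
    ∀ S : Finset κ, S.Nonempty →
      (∑ j ∈ S, u j ≤ 1 ∧ ∑ j ∈ S, v j ≤ 1) ∧
      ∏ j ∈ S, ffun s t (u j) (v j) ≤ (s * t) ^ (S.card - 1) * ffun s t (∑ j ∈ S, u j) (∑ j ∈ S, v j) := by
  intro S hS
  induction hS using Finset.Nonempty.cons_induction with
  | singleton i =>
    refine ⟨⟨by simpa using hu1 i, by simpa using hv1 i⟩, ?_⟩
    simp
  | cons i S hi hS ih =>
    obtain ⟨⟨ihu, ihv⟩, ihp⟩ := ih
    rw [sum_cons, sum_cons, prod_cons, card_cons]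
    -- the new block is orthogonal to the merged old block
    have huS : u i * ∑ j ∈ S, u j = 0 := by
      rw [mul_sum]; exact sum_eq_zero fun j hj => hu i j (fun h => hi (h ▸ hj))
    have hvS : v i * ∑ j ∈ S, v j = 0 := by
      rw [mul_sum]; exact sum_eq_zero fun j hj => hv i j (fun h => hi (h ▸ hj))
    have hSu0 : 0 ≤ ∑ j ∈ S, u j := sum_nonneg fun j _ => hu0 j
    have hSv0 : 0 ≤ ∑ j ∈ S, v j := sum_nonneg fun j _ => hv0 j
    have hsum_u : u i + ∑ j ∈ S, u j ≤ 1 := by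
      rcases mul_eq_zero.1 huS with h | h
      · rw [h, zero_add]; exact ihu
      · rw [h, add_zero]; exact hu1 i
    have hsum_v : v i + ∑ j ∈ S, v j ≤ 1 := by
      rcases mul_eq_zero.1 hvS with h | h
      · rw [h, zero_add]; exact ihv
      · rw [h, add_zero]; exact hv1 i
    refine ⟨⟨hsum_u, hsum_v⟩, ?_⟩
    have hmerge := ffun_merge hs hs1 ht ht1 (hu0 i) (hu1 i) (hv0 i) (hv1 i) hSu0 ihu hSv0 ihv huS hvS
    have hfi : 0 ≤ ffun s t (u i) (v i) := by
      unfold ffun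
      have : 0 ≤ min (u i) (v i) := le_min (hu0 i) (hv0 i)
      have := hu0 i; have := hv0 i
      have : 0 ≤ 1 - s := by linarith
      have : 0 ≤ 1 - t := by linarith
      positivity
    have hst : 0 ≤ s * t := mul_nonneg hs ht
    have hcard : S.card + 1 - 1 = (S.card - 1) + 1 := by
      have := hS.card_pos; omega
    calc ffun s t (u i) (v i) * ∏ j ∈ S, ffun s t (u j) (v j)
        ≤ ffun s t (u i) (v i) * ((s * t) ^ (S.card - 1) * ffun s t (∑ j ∈ S, u j) (∑ j ∈ S, v j)) :=
          mul_le_mul_of_nonneg_left ihp hfi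
      _ = (s * t) ^ (S.card - 1) * (ffun s t (u i) (v i) * ffun s t (∑ j ∈ S, u j) (∑ j ∈ S, v j)) := by ring
      _ ≤ (s * t) ^ (S.card - 1) * (s * t * ffun s t (u i + ∑ j ∈ S, u j) (v i + ∑ j ∈ S, v j)) :=
          mul_le_mul_of_nonneg_left hmerge (pow_nonneg hst _)
      _ = (s * t) ^ (S.card + 1 - 1) * ffun s t (u i + ∑ j ∈ S, u j) (v i + ∑ j ∈ S, v j) := by
          rw [hcard, pow_succ]; ring

/-- **Two-coin bound (`a = 0`).**  With only the pairwise constraints `u_iu_j = 0 = v_iv_j` (`i ≠ j`):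
`∏_j (st·x_j + s(1−t)u_j + (1−s)t·v_j + (1−s)(1−t)m_j) ≤ (st)^(n−1)`. [this work] -/
theorem two_coin_prod_le_zero {n : ℕ} {s t : ℝ} (hs : 0 ≤ s) (hs1 : s ≤ 1) (ht : 0 ≤ t) (ht1 : t ≤ 1)
    (x u v m : Fin n → ℝ) (hx0 : ∀ j, 0 ≤ x j) (hx1 : ∀ j, x j ≤ 1) (hu0 : ∀ j, 0 ≤ u j) (hu1 : ∀ j, u j ≤ 1)
    (hv0 : ∀ j, 0 ≤ v j) (hv1 : ∀ j, v j ≤ 1) (hm0 : ∀ j, 0 ≤ m j) (hmu : ∀ j, m j ≤ u j) (hmv : ∀ j, m j ≤ v j)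
    (hu : ∀ i j, i ≠ j → u i * u j = 0) (hv : ∀ i j, i ≠ j → v i * v j = 0) :
    ∏ j, (s * t * x j + s * (1 - t) * u j + (1 - s) * t * v j + (1 - s) * (1 - t) * m j) ≤ (s * t) ^ (n - 1) := by
  classical
  rcases Nat.eq_zero_or_pos n with hn | hn
  · subst hn; simp
  have hs' : 0 ≤ 1 - s := by linarith
  have ht' : 0 ≤ 1 - t := by linarith
  have hfac : ∀ j, s * t * x j + s * (1 - t) * u j + (1 - s) * t * v j + (1 - s) * (1 - t) * m j ≤
      ffun s t (u j) (v j) := by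
    intro j
    unfold ffun
    have e1 : s * t * x j ≤ s * t := by nlinarith [hx1 j, mul_nonneg hs ht]
    have e2 : (1 - s) * (1 - t) * m j ≤ (1 - s) * (1 - t) * min (u j) (v j) :=
      mul_le_mul_of_nonneg_left (le_min (hmu j) (hmv j)) (mul_nonneg hs' ht')
    linarith
  have hfac0 : ∀ j, 0 ≤ s * t * x j + s * (1 - t) * u j + (1 - s) * t * v j + (1 - s) * (1 - t) * m j := by
    intro j
    have := hx0 j; have := hm0 j; have := hu0 j; have := hv0 j
    positivity
  have hne : (univ : Finset (Fin n)).Nonempty := univ_nonempty_iff.2 ⟨⟨0, hn⟩⟩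
  obtain ⟨⟨hsu, hsv⟩, key⟩ := prod_ffun_le_merged hs hs1 ht ht1 u v hu0 hu1 hv0 hv1 hu hv univ hne
  rw [card_univ, Fintype.card_fin] at key
  have hsu0 : 0 ≤ ∑ j, u j := sum_nonneg fun j _ => hu0 j
  have hsv0 : 0 ≤ ∑ j, v j := sum_nonneg fun j _ => hv0 j
  have htop : ffun s t (∑ j, u j) (∑ j, v j) ≤ 1 := by
    unfold ffun
    have hmin : min (∑ j, u j) (∑ j, v j) ≤ 1 := (min_le_left _ _).trans hsu
    have e1 : s * (1 - t) * ∑ j, u j ≤ s * (1 - t) := by nlinarith [mul_nonneg hs ht']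
    have e2 : (1 - s) * t * ∑ j, v j ≤ (1 - s) * t := by nlinarith [mul_nonneg hs' ht]
    have e3 : (1 - s) * (1 - t) * min (∑ j, u j) (∑ j, v j) ≤ (1 - s) * (1 - t) := by
      nlinarith [mul_nonneg hs' ht']
    nlinarith
  have hst : 0 ≤ s * t := mul_nonneg hs ht
  calc ∏ j, (s * t * x j + s * (1 - t) * u j + (1 - s) * t * v j + (1 - s) * (1 - t) * m j)
      ≤ ∏ j, ffun s t (u j) (v j) := prod_le_prod (fun j _ => hfac0 j) fun j _ => hfac j
    _ ≤ (s * t) ^ (n - 1) * ffun s t (∑ j, u j) (∑ j, v j) := key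
    _ ≤ (s * t) ^ (n - 1) * 1 := mul_le_mul_of_nonneg_left htop (pow_nonneg hst _)
    _ = (s * t) ^ (n - 1) := mul_one _

end UnionEdge

end SafeCalc

end Summit.CriticalPhenomena.PercolationContinuityZ3.Theorems.SunflowerPartition
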